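import Literature.Probability.Process.BurkholderSubordination
import Summits.NavierStokesRegularity.FunctionalMining.StretchingLaminateSextic
import Summits.NavierStokesRegularity.FunctionalMining.StretchingLaminateSupermartingale
import Mathlib.Analysis.InnerProductSpace.PiL2
import Mathlib.Analysis.SpecialFunctions.Exp
import Mathlib.Algebra.BigOperators.Fin
import Mathlib.Tactic.Linarith
import Mathlib.Tactic.FinCases
import HarnessLib

/-!
# FunctionalMining — K1-Q1 laminates, L-CAP-B kernel port (1): Burkholder's `u_λ` on lamination trees — profile, dictionary, leaf node

search for candidate a priori estimates; no regularity claim.  Cell `pub-nsfunc`, prove seat gen 7.  First file of the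
kernel port of the bank seat's THEOREM L-CAP-B (`HOME/pub-nsfunc-bank/K1Q1-LAMINATE-BURKHOLDER.md` §1–§3, §7–§8; dict
typing notes 134/134a): a laminate cap `C_lam ≤ θ_B` from Burkholder's bounded-martingale function `u_λ` (Literature
`burkholderU`, LNM 1464 (1991) §8), CONDITIONAL on the vendored named fact `Burkholder1991_keyFunction` (used downstream
as an explicit hypothesis; nothing of it is asserted here).  Contents (elementary bookkeeping):
* `Burk.uProf λ r z` — the radial profile of the PRINTED CLOSED FORMS (`burkholderU λ x y = uProf λ ‖x‖ ‖y‖`, `rfl`;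
  transfer `uProf λ r z = burkholderU λ (r : ℝ) (z : ℝ)` for `r, z ≥ 0`), `Burk.uCore` (interior cascade on `ℝ × ℝ`),
  `Burk.abar λ = α e^{−λ} = u_λ(0,0)`; the sphere face `uProf λ 1 z = 1_{λ ≤ z}`, the centre face (`= ᾱ(1+z²)` for
  `z ≤ 1`, `≥ ½` for `z ≥ λ−1`, `= 1` for `z² ≥ λ²−1`, `≥ ᾱ`), the exact forms on `D₀ = {r + z ≤ 1}` and
  `D₁ = {1 ≤ r + z < λ − 1}` (sphere included) and the tangent minorant `2ᾱ(1−r)(r+z) ≤ u` on `D₁`;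
* THE DICTIONARY (bank §1) in the tree's rational lamination calculus: `x(G) = ω_G/M`, `y(G) = √2·S_G/M` in
  `EuclideanSpace ℝ (Fin 6)` (`Grad.xVec/yVec`, strain in Frobenius-isometric coordinates), split increments `h = w/M`,
  `k = √2·sym(c⊗n)/M` (`Split.hVec/kVec`); affine along layers, `‖x‖² = |ω|²/M²`, `‖y‖² = 2|S|²/M²`, and
  **`‖k‖ = ‖h‖` on a div-free split** (`Split.norm_kVec_eq` — the equality case of differential subordination);
* `Laminate.burkNode λ M G := u_λ(x(G), y(G))` (and the scaled `burkNodeS`, `u_λ(σx, σ²y)`), and the TYPED per-leaf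
  inequality `Laminate.LeafClaimB` of the Burkholder dual certificate (`LeafClaim6` of (au) plus
  `M³ Σ_k c_k (u_{λ_k}(leaf) − ᾱ_{λ_k})`) — typed only, NOT asserted.
Nothing here is a statement about Navier–Stokes solutions; no bound on `C_lam` or `C⋆` is proved in this file.
-/

noncomputable section

namespace Summit.NavierStokesRegularity.FunctionalMining

namespace Burk

open Literature.Probability.Process

/-! ## The profile and the transfer to the Literature definition -/

/-- `ᾱ_λ := α·e^{−λ}` (`α = e²/4`), the value `u_λ(0,0)` (Burkholder 1991, (8.7)). [ours; bookkeeping] -/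
def abar (lam : ℝ) : ℝ := burkholderAlpha * Real.exp (-lam)

/-- `ᾱ_λ > 0`. [ours; bookkeeping] -/
theorem abar_pos (lam : ℝ) : 0 < abar lam := mul_pos burkholderAlpha_pos (Real.exp_pos _)

/-- **The radial profile of Burkholder's `u_λ`**: the printed five-piece function of `(r, z) = (‖x‖, ‖y‖)`
(same case split, same boundary conventions as `Literature.Probability.Process.burkholderU`). [ours; bookkeeping] -/
def uProf (lam r z : ℝ) : ℝ :=
  if r = 1 then (if lam ≤ z then 1 else 0)
  else if lam ^ 2 - 1 + r ^ 2 < z ^ 2 then 1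
  else if lam - 1 + r ≤ z then 1 - (lam ^ 2 - 1 - z ^ 2 + r ^ 2) / (4 * (lam - 1))
  else if lam - 1 - r ≤ z then (1 - r ^ 2) / ((lam - z) ^ 2 + 1 - r ^ 2)
  else if 1 ≤ r + z then 2 * burkholderAlpha * (1 - r) * Real.exp (r + z - lam - 1)
  else burkholderAlpha * (1 + z ^ 2 - r ^ 2) * Real.exp (-lam)

/-- `u_λ(x, y)` is the profile at `(‖x‖, ‖y‖)` (definitional). [ours; bookkeeping] -/
theorem burkholderU_eq_uProf {E : Type*} [NormedAddCommGroup E] (lam : ℝ) (x y : E) :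
    burkholderU lam x y = uProf lam ‖x‖ ‖y‖ := rfl

/-- The interior cascade of the profile as a function on `ℝ × ℝ` (no sphere branch): the object whose continuity on
`{|r| < 1}` drives the limit argument of `(TB)` (file `…BurkholderLimit`). [ours; bookkeeping] -/
def uCore (lam : ℝ) (p : ℝ × ℝ) : ℝ :=
  if lam ^ 2 - 1 + p.1 ^ 2 < p.2 ^ 2 then 1
  else if lam - 1 + p.1 ≤ p.2 then 1 - (lam ^ 2 - 1 - p.2 ^ 2 + p.1 ^ 2) / (4 * (lam - 1))
  else if lam - 1 - p.1 ≤ p.2 then (1 - p.1 ^ 2) / ((lam - p.2) ^ 2 + 1 - p.1 ^ 2)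
  else if 1 ≤ p.1 + p.2 then 2 * burkholderAlpha * (1 - p.1) * Real.exp (p.1 + p.2 - lam - 1)
  else burkholderAlpha * (1 + p.2 ^ 2 - p.1 ^ 2) * Real.exp (-lam)

/-- Off the sphere the profile is the interior cascade: `r ≠ 1 → uProf λ r z = uCore λ (r, z)`. [ours; bookkeeping] -/
theorem uProf_eq_uCore {lam r z : ℝ} (hr : r ≠ 1) : uProf lam r z = uCore lam (r, z) := by
  unfold uProf uCore; rw [if_neg hr]

/-- Transfer: for `r, z ≥ 0` the profile is `u_λ` on the real line, `uProf λ r z = burkholderU λ r z` (`‖r‖ = r`).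
[ours; bookkeeping] -/
theorem uProf_eq_burkholderU_real {lam r z : ℝ} (hr : 0 ≤ r) (hz : 0 ≤ z) :
    uProf lam r z = burkholderU lam r z := by
  rw [burkholderU_eq_uProf, Real.norm_eq_abs, Real.norm_eq_abs, abs_of_nonneg hr, abs_of_nonneg hz]

/-- `0 ≤ uProf λ r z ≤ 1` for `0 ≤ r ≤ 1`, `0 ≤ z` (`λ > 2`; Literature `burkholderU_mem_Icc`). [ours; bookkeeping] -/
theorem uProf_mem_Icc {lam r z : ℝ} (hlam : 2 < lam) (hr0 : 0 ≤ r) (hr1 : r ≤ 1) (hz : 0 ≤ z) :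
    uProf lam r z ∈ Set.Icc (0 : ℝ) 1 := by
  rw [uProf_eq_burkholderU_real hr0 hz]
  exact burkholderU_mem_Icc hlam (by rw [Real.norm_eq_abs, abs_of_nonneg hr0]; exact hr1) _

/-- `0 ≤ uProf λ r z` on the closed ball. [ours; bookkeeping] -/
theorem uProf_nonneg {lam r z : ℝ} (hlam : 2 < lam) (hr0 : 0 ≤ r) (hr1 : r ≤ 1) (hz : 0 ≤ z) :
    0 ≤ uProf lam r z := (uProf_mem_Icc hlam hr0 hr1 hz).1

/-- `uProf λ 0 0 = ᾱ_λ` (Literature `burkholderU_zero_zero`). [ours; bookkeeping] -/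
theorem uProf_zero_zero {lam : ℝ} (hlam : 2 < lam) : uProf lam 0 0 = abar lam := by
  rw [uProf_eq_burkholderU_real le_rfl le_rfl]
  exact burkholderU_zero_zero hlam

/-- **`ᾱ_λ ≤ uProf λ 0 z`** for `z ≥ 0` (monotonicity of `u_λ(0,·)`, Literature `burkholderU_zero_mono`). [ours; bookkeeping] -/
theorem abar_le_uProf_zero {lam z : ℝ} (hlam : 2 < lam) (hz : 0 ≤ z) : abar lam ≤ uProf lam 0 z := by
  rw [uProf_eq_burkholderU_real le_rfl hz]
  have h := burkholderU_zero_mono (E := ℝ) hlam (y := (0 : ℝ)) (y' := z)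
    (by rw [norm_zero, Real.norm_eq_abs, abs_of_nonneg hz]; exact hz)
  rw [burkholderU_zero_zero hlam] at h
  exact h

/-! ## The sphere face `r = 1` -/

/-- **On the sphere `u_λ` is the indicator of `{z ≥ λ}`**: `uProf λ 1 z = 1_{λ ≤ z}`. [ours; bookkeeping] -/
theorem uProf_one (lam z : ℝ) : uProf lam 1 z = if lam ≤ z then 1 else 0 := by
  unfold uProf; rw [if_pos rfl]

/-- Sphere face, upper part: `λ ≤ z → uProf λ 1 z = 1`. [ours; bookkeeping] -/
theorem uProf_one_of_le {lam z : ℝ} (h : lam ≤ z) : uProf lam 1 z = 1 := by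
  rw [uProf_one, if_pos h]

/-- Sphere face, lower part: `z < λ → uProf λ 1 z = 0`. [ours; bookkeeping] -/
theorem uProf_one_of_lt {lam z : ℝ} (h : z < lam) : uProf lam 1 z = 0 := by
  rw [uProf_one, if_neg (not_le.2 h)]

/-! ## The centre face `r = 0` -/

/-- The centre profile `uProf λ 0 z` in closed form (four pieces; the `D₂` window is empty at `r = 0`). [ours; bookkeeping] -/
theorem uProf_zero_eq (lam z : ℝ) : uProf lam 0 z =
    if lam ^ 2 - 1 < z ^ 2 then 1
    else if lam - 1 ≤ z then 1 - (lam ^ 2 - 1 - z ^ 2) / (4 * (lam - 1))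
    else if 1 ≤ z then 2 * burkholderAlpha * Real.exp (z - lam - 1)
    else burkholderAlpha * (1 + z ^ 2) * Real.exp (-lam) := by
  unfold uProf
  rw [if_neg (by norm_num)]
  simp only [zero_pow two_ne_zero, add_zero, sub_zero, mul_one, zero_add]
  by_cases h4 : lam ^ 2 - 1 < z ^ 2
  · rw [if_pos h4, if_pos h4]
  · rw [if_neg h4, if_neg h4]
    by_cases h3 : lam - 1 ≤ z
    · rw [if_pos h3, if_pos h3]
    · rw [if_neg h3, if_neg h3, if_neg h3]

/-- **Centre face, small strain: `uProf λ 0 z = ᾱ_λ (1 + z²)` for `0 ≤ z ≤ 1`** (`λ > 2`). [ours; bookkeeping] -/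
theorem uProf_zero_small {lam z : ℝ} (hlam : 2 < lam) (hz0 : 0 ≤ z) (hz1 : z ≤ 1) :
    uProf lam 0 z = abar lam * (1 + z ^ 2) := by
  rw [uProf_zero_eq]
  have hz2 : z ^ 2 ≤ 1 := by nlinarith
  rw [if_neg (by nlinarith), if_neg (by linarith)]
  by_cases h1 : 1 ≤ z
  · have hz : z = 1 := le_antisymm hz1 h1
    rw [if_pos h1, hz, show (1 : ℝ) - lam - 1 = -lam by ring]
    unfold abar; ring
  · rw [if_neg h1]; unfold abar; ring

/-- **Centre face, one step below the threshold: `½ ≤ uProf λ 0 z` for `z ≥ λ − 1`** (`λ > 2`). [ours; bookkeeping] -/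
theorem half_le_uProf_zero {lam z : ℝ} (hlam : 2 < lam) (hz : lam - 1 ≤ z) : 1 / 2 ≤ uProf lam 0 z := by
  rw [uProf_zero_eq]
  by_cases h4 : lam ^ 2 - 1 < z ^ 2
  · rw [if_pos h4]; norm_num
  · rw [if_neg h4, if_pos hz]
    have hl1 : 0 < 4 * (lam - 1) := by linarith
    have hzz : (lam - 1) ^ 2 ≤ z ^ 2 := by nlinarith
    have h1 : (lam ^ 2 - 1 - z ^ 2) / (4 * (lam - 1)) ≤ 1 / 2 := by
      rw [div_le_iff₀ hl1]; nlinarith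
    linarith

/-- **Centre face, at and above the threshold: `uProf λ 0 z = 1` for `z ≥ 0`, `z² ≥ λ² − 1`** (`λ > 2`). [ours; bookkeeping] -/
theorem uProf_zero_eq_one {lam z : ℝ} (hlam : 2 < lam) (hz0 : 0 ≤ z) (hz : lam ^ 2 - 1 ≤ z ^ 2) :
    uProf lam 0 z = 1 := by
  rw [uProf_zero_eq]
  by_cases h4 : lam ^ 2 - 1 < z ^ 2
  · rw [if_pos h4]
  · have heq : z ^ 2 = lam ^ 2 - 1 := le_antisymm (not_lt.1 h4) hz
    have h3 : lam - 1 ≤ z := by nlinarith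
    rw [if_neg h4, if_pos h3, heq]; ring

/-! ## The exact forms near the origin: `D₀ = {r + z ≤ 1}` and `D₁ = {1 ≤ r + z < λ − 1}` (sphere included) -/

/-- **On `D₀` (closed, sphere point `(1,0)` included): `uProf λ r z = ᾱ_λ (1 + z² − r²)`** for `0 ≤ r ≤ 1`, `0 ≤ z`,
`r + z ≤ 1`, `λ > 2`. [ours; bookkeeping] -/
theorem uProf_D0 {lam r z : ℝ} (hlam : 2 < lam) (hr0 : 0 ≤ r) (hr1 : r ≤ 1) (hz : 0 ≤ z) (h : r + z ≤ 1) :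
    uProf lam r z = abar lam * (1 + z ^ 2 - r ^ 2) := by
  unfold uProf
  by_cases hr : r = 1
  · have hz0 : z = 0 := by linarith
    rw [if_pos hr, if_neg (by rw [hz0]; linarith), hr, hz0]; ring
  · have hr' : r < 1 := lt_of_le_of_ne hr1 hr
    have hz1 : z ≤ 1 := by linarith
    have hz2 : z ^ 2 ≤ 1 := by nlinarith
    rw [if_neg hr, if_neg (by nlinarith), if_neg (by linarith), if_neg (by linarith)]
    by_cases h1 : 1 ≤ r + z
    · have hz' : z = 1 - r := by linarith
      rw [if_pos h1, show r + z - lam - 1 = -lam by linarith, hz']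
      unfold abar; ring
    · rw [if_neg h1]; unfold abar; ring

/-- **On `D₁` (sphere included): `uProf λ r z = 2α(1 − r)e^{r+z−λ−1}`** for `0 ≤ r`, `0 ≤ z`, `1 ≤ r + z`,
`r + z < λ − 1`, `λ > 2`. [ours; bookkeeping] -/
theorem uProf_D1 {lam r z : ℝ} (hlam : 2 < lam) (hr0 : 0 ≤ r) (hz : 0 ≤ z) (h1 : 1 ≤ r + z)
    (h2 : r + z < lam - 1) :
    uProf lam r z = 2 * burkholderAlpha * (1 - r) * Real.exp (r + z - lam - 1) := by
  unfold uProf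
  by_cases hr : r = 1
  · rw [if_pos hr, if_neg (by rw [hr] at h2; linarith), hr]; ring
  · have hzl : z < lam - 1 := by linarith
    have hz2 : z ^ 2 < (lam - 1) ^ 2 := by nlinarith
    rw [if_neg hr, if_neg (by nlinarith), if_neg (by linarith), if_neg (by linarith), if_pos h1]

/-- **Tangent minorant on `D₁`: `2ᾱ_λ(1 − r)(r + z) ≤ uProf λ r z`** (`e^{t} ≥ 1 + t` at `t = r + z − 1`), same
hypotheses as `uProf_D1`. [ours; elementary] -/
theorem uProf_D1_ge {lam r z : ℝ} (hlam : 2 < lam) (hr0 : 0 ≤ r) (hr1 : r ≤ 1) (hz : 0 ≤ z) (h1 : 1 ≤ r + z)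
    (h2 : r + z < lam - 1) :
    2 * abar lam * (1 - r) * (r + z) ≤ uProf lam r z := by
  rw [uProf_D1 hlam hr0 hz h1 h2, show r + z - lam - 1 = -lam + (r + z - 1) by ring, Real.exp_add]
  have he : r + z ≤ Real.exp (r + z - 1) := by
    have := Real.add_one_le_exp (r + z - 1); linarith
  have hc : 0 ≤ 2 * burkholderAlpha * (1 - r) * Real.exp (-lam) :=
    mul_nonneg (mul_nonneg (mul_nonneg (by norm_num) burkholderAlpha_pos.le) (by linarith)) (Real.exp_pos _).le
  unfold abar
  calc 2 * (burkholderAlpha * Real.exp (-lam)) * (1 - r) * (r + z)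
      = (2 * burkholderAlpha * (1 - r) * Real.exp (-lam)) * (r + z) := by ring
    _ ≤ (2 * burkholderAlpha * (1 - r) * Real.exp (-lam)) * Real.exp (r + z - 1) :=
        mul_le_mul_of_nonneg_left he hc
    _ = 2 * burkholderAlpha * (1 - r) * (Real.exp (-lam) * Real.exp (r + z - 1)) := by ring

end Burk

/-! ## The dictionary: node states and splits as vectors of `E = EuclideanSpace ℝ (Fin 6)` -/

namespace Laminate

open Burk Literature.Probability.Process

/-- The ambient Hilbert space of the dictionary, `ℝ⁶` (vorticity in the first three coordinates for `x`; the strain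
in Frobenius-isometric coordinates for `y`). [ours; bookkeeping] -/
abbrev E6 : Type := EuclideanSpace ℝ (Fin 6)

namespace Grad

/-- `x(G) = ω_G / M` (padded with zeros). [ours; bookkeeping] -/
def xVec (M : ℝ) (G : Grad) : E6 :=
  WithLp.toLp 2 ![(G.vort0 : ℝ) / M, (G.vort1 : ℝ) / M, (G.vort2 : ℝ) / M, 0, 0, 0]

/-- `y(G) = √2·S_G / M` in the coordinates `(√2 S₀₀, √2 S₁₁, √2 S₂₂, 2S₀₁, 2S₀₂, 2S₁₂)/M` (`2S₀₁ = G₀₁ + G₁₀`, …), so that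
`‖y(G)‖² = 2|S_G|_F²/M²`. [ours; bookkeeping] -/
def yVec (M : ℝ) (G : Grad) : E6 :=
  WithLp.toLp 2 ![Real.sqrt 2 * (G.g00 : ℝ) / M, Real.sqrt 2 * (G.g11 : ℝ) / M, Real.sqrt 2 * (G.g22 : ℝ) / M,
    ((G.g01 : ℝ) + (G.g10 : ℝ)) / M, ((G.g02 : ℝ) + (G.g20 : ℝ)) / M, ((G.g12 : ℝ) + (G.g21 : ℝ)) / M]

end Grad

namespace Split

/-- The vorticity increment of a layer, `h = w/M = (n × c)/M`. [ours; bookkeeping] -/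
def hVec (M : ℝ) (s : Split) : E6 :=
  WithLp.toLp 2 ![(s.w0 : ℝ) / M, (s.w1 : ℝ) / M, (s.w2 : ℝ) / M, 0, 0, 0]

/-- The strain increment of a layer, `k = √2·sym(c ⊗ n)/M` in the coordinates of `yVec`. [ours; bookkeeping] -/
def kVec (M : ℝ) (s : Split) : E6 :=
  WithLp.toLp 2 ![Real.sqrt 2 * ((s.c0 : ℝ) * s.n0) / M, Real.sqrt 2 * ((s.c1 : ℝ) * s.n1) / M,
    Real.sqrt 2 * ((s.c2 : ℝ) * s.n2) / M, ((s.c0 : ℝ) * s.n1 + s.c1 * s.n0) / M,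
    ((s.c0 : ℝ) * s.n2 + s.c2 * s.n0) / M, ((s.c1 : ℝ) * s.n2 + s.c2 * s.n1) / M]

end Split

namespace Grad

/-- **`x` is affine along layers**: `x(G + t c⊗n) = x(G) + t·h`. [ours; elementary] -/
theorem xVec_layer (M : ℝ) (G : Grad) (t : ℚ) (s : Split) :
    (G.layer t s).xVec M = G.xVec M + (t : ℝ) • s.hVec M := by
  ext i
  fin_cases i <;>
    simp [xVec, Split.hVec, vort0_layer, vort1_layer, vort2_layer] <;> ring

/-- **`y` is affine along layers**: `y(G + t c⊗n) = y(G) + t·k`. [ours; elementary] -/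
theorem yVec_layer (M : ℝ) (G : Grad) (t : ℚ) (s : Split) :
    (G.layer t s).yVec M = G.yVec M + (t : ℝ) • s.kVec M := by
  ext i
  fin_cases i <;> simp [yVec, Split.kVec, layer] <;> ring

/-- `x(0) = 0`. [ours; bookkeeping] -/
theorem xVec_zero (M : ℝ) : Grad.zero.xVec M = 0 := by
  ext i; fin_cases i <;> simp [xVec, zero, vort0, vort1, vort2]

/-- `y(0) = 0`. [ours; bookkeeping] -/
theorem yVec_zero (M : ℝ) : Grad.zero.yVec M = 0 := by
  ext i; fin_cases i <;> simp [yVec, zero]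

/-- `‖x(G)‖² = |ω_G|²/M²`. [ours; elementary] -/
theorem norm_xVec_sq (M : ℝ) (G : Grad) : ‖G.xVec M‖ ^ 2 = (G.vortSq : ℝ) / M ^ 2 := by
  rw [EuclideanSpace.real_norm_sq_eq]
  simp [xVec, Fin.sum_univ_succ, vortSq]
  ring

/-- `‖y(G)‖² = 2|S_G|²/M²`. [ours; elementary] -/
theorem norm_yVec_sq (M : ℝ) (G : Grad) : ‖G.yVec M‖ ^ 2 = 2 * (G.sSq : ℝ) / M ^ 2 := by
  have h2 : Real.sqrt 2 ^ 2 = 2 := Real.sq_sqrt (by norm_num)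
  have key : ∀ t : ℝ, (Real.sqrt 2 * t / M) ^ 2 = 2 * t ^ 2 / M ^ 2 := fun t => by
    rw [div_pow, mul_pow, h2]
  rw [EuclideanSpace.real_norm_sq_eq]
  simp [yVec, Fin.sum_univ_succ, sSq, key]
  ring

/-- `‖x(G)‖ = √(|ω_G|²)/M` for `M > 0`. [ours; elementary] -/
theorem norm_xVec {M : ℝ} (hM : 0 < M) (G : Grad) : ‖G.xVec M‖ = Real.sqrt (G.vortSq : ℝ) / M := by
  have h := norm_xVec_sq M G
  have hx : 0 ≤ ‖G.xVec M‖ := norm_nonneg _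
  rw [← Real.sqrt_sq hx, h, Real.sqrt_div' _ (sq_nonneg M), Real.sqrt_sq hM.le]

/-- `‖y(G)‖ = √(2|S_G|²)/M` for `M > 0`. [ours; elementary] -/
theorem norm_yVec {M : ℝ} (hM : 0 < M) (G : Grad) : ‖G.yVec M‖ = Real.sqrt (2 * (G.sSq : ℝ)) / M := by
  have h := norm_yVec_sq M G
  have hx : 0 ≤ ‖G.yVec M‖ := norm_nonneg _
  rw [← Real.sqrt_sq hx, h, Real.sqrt_div' _ (sq_nonneg M), Real.sqrt_sq hM.le]

end Grad

namespace Split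

/-- `‖h‖² = |w|²/M²`. [ours; elementary] -/
theorem norm_hVec_sq (M : ℝ) (s : Split) : ‖s.hVec M‖ ^ 2 = (s.wSq : ℝ) / M ^ 2 := by
  rw [EuclideanSpace.real_norm_sq_eq]
  simp [hVec, Fin.sum_univ_succ, wSq]
  ring

/-- `‖k‖² = (|w|² + 2(c·n)²)/M²` (the dictionary's isometry defect, cf. `two_symSq_sub_wSq`). [ours; elementary] -/
theorem norm_kVec_sq (M : ℝ) (s : Split) : ‖s.kVec M‖ ^ 2 = ((s.wSq : ℝ) + 2 * (s.dot : ℝ) ^ 2) / M ^ 2 := by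
  have h2 : Real.sqrt 2 ^ 2 = 2 := Real.sq_sqrt (by norm_num)
  have key : ∀ t : ℝ, (Real.sqrt 2 * t / M) ^ 2 = 2 * t ^ 2 / M ^ 2 := fun t => by
    rw [div_pow, mul_pow, h2]
  rw [EuclideanSpace.real_norm_sq_eq]
  simp [kVec, Fin.sum_univ_succ, wSq, w0, w1, w2, dot, key]
  ring

/-- **Equality case of differential subordination on a div-free split: `‖k‖ = ‖h‖`** (`c·n = 0`). [ours; elementary] -/
theorem norm_kVec_eq (M : ℝ) (s : Split) (h : s.dot = 0) : ‖s.kVec M‖ = ‖s.hVec M‖ := by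
  have hk := norm_kVec_sq M s
  rw [h] at hk
  push_cast at hk
  simp only [ne_eq, OfNat.ofNat_ne_zero, not_false_eq_true, zero_pow, mul_zero, add_zero] at hk
  rw [← norm_hVec_sq M s] at hk
  exact (sq_eq_sq₀ (norm_nonneg _) (norm_nonneg _)).1 hk

end Split

/-! ## The node functional `u_λ(x(G), y(G))` and the typed leaf certificate -/

/-- **The Burkholder node functional** `burkNode λ M G := u_λ(ω_G/M, √2 S_G/M)`. [ours; bookkeeping] -/
def burkNode (lam M : ℝ) (G : Grad) : ℝ := burkholderU lam (G.xVec M) (G.yVec M)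

/-- The node functional through the profile: `burkNode λ M G = uProf λ (√|ω|²/M) (√(2|S|²)/M)` (`M > 0`). [ours; bookkeeping] -/
theorem burkNode_eq_uProf {lam M : ℝ} (hM : 0 < M) (G : Grad) :
    burkNode lam M G = uProf lam (Real.sqrt (G.vortSq : ℝ) / M) (Real.sqrt (2 * (G.sSq : ℝ)) / M) := by
  rw [burkNode, burkholderU_eq_uProf, Grad.norm_xVec hM, Grad.norm_yVec hM]

/-- At the root: `burkNode λ M 0 = ᾱ_λ` (`λ > 2`). [ours; bookkeeping] -/
theorem burkNode_zero {lam : ℝ} (hlam : 2 < lam) (M : ℝ) : burkNode lam M Grad.zero = abar lam := by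
  rw [burkNode, Grad.xVec_zero, Grad.yVec_zero]
  exact burkholderU_zero_zero hlam

/-- **The SCALED node functional** `burkNodeS λ M σ G := u_λ(σ·x(G), σ²·y(G))` (`0 < σ < 1` puts every node strictly
inside the ball and makes the strain increments STRICTLY subordinate, `‖σ²k‖ < ‖σh‖`; `σ → 1⁻` recovers `burkNode`).
[ours; bookkeeping] -/
def burkNodeS (lam M σ : ℝ) (G : Grad) : ℝ := burkholderU lam (σ • G.xVec M) (σ ^ 2 • G.yVec M)

/-- `burkNodeS λ M 1 = burkNode λ M`. [ours; bookkeeping] -/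
theorem burkNodeS_one (lam M : ℝ) : burkNodeS lam M 1 = burkNode lam M := by
  funext G; simp [burkNodeS, burkNode]

/-- The scaled functional through the profile (`M > 0`, `σ ≥ 0`):
`burkNodeS λ M σ G = uProf λ (σ·√|ω|²/M) (σ²·√(2|S|²)/M)`. [ours; bookkeeping] -/
theorem burkNodeS_eq_uProf {lam M σ : ℝ} (hM : 0 < M) (hσ : 0 ≤ σ) (G : Grad) :
    burkNodeS lam M σ G
      = uProf lam (σ * (Real.sqrt (G.vortSq : ℝ) / M)) (σ ^ 2 * (Real.sqrt (2 * (G.sSq : ℝ)) / M)) := by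
  rw [burkNodeS, burkholderU_eq_uProf, norm_smul, norm_smul, Grad.norm_xVec hM, Grad.norm_yVec hM,
    Real.norm_eq_abs, Real.norm_eq_abs, abs_of_nonneg hσ, abs_of_nonneg (pow_nonneg hσ 2)]

/-- At the root the scaled functional is `ᾱ_λ` for every `σ` (`λ > 2`). [ours; bookkeeping] -/
theorem burkNodeS_zero {lam : ℝ} (hlam : 2 < lam) (M σ : ℝ) : burkNodeS lam M σ Grad.zero = abar lam := by
  rw [burkNodeS, Grad.xVec_zero, Grad.yVec_zero, smul_zero, smul_zero]
  exact burkholderU_zero_zero hlam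

/-- **Typed node (NOT asserted): the pointwise LEAF INEQUALITY of the Burkholder dual certificate**, homogeneous form,
with `n` thresholds `λ_k` and weights `c_k`.  For every trace-free rational state `G` and real `M > 0` with `|ω(G)|² ≤ M²`:
`(1 − ¾b)·ωᵀSω ≤ θ·M·|S|² + a·M·(|S|² − ½|ω|²) + b·tr S³ + (c/M³)·(U₆(G) − 1178M⁶) + M³·Σ_k c_k (u_{λ_k}(x(G), y(G)) − ᾱ_{λ_k})`
(bank K1Q1-LAMINATE-BURKHOLDER §3 `Φ ≤ 0`, with the `(I1)`, `(I2)`, `(T6)`, `(TB)` multipliers displayed).  With `(TB)`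
`Σ_L W_L u_λ(leaf) ≤ ᾱ_λ` (file `…BurkholderTree`, conditional on the Burkholder named fact) it gives `RatioBound θ`
(file `…BurkholderLeaf`). [ours; typed node] -/
def LeafClaimB (θ a b c : ℝ) {n : ℕ} (lam cs : Fin n → ℝ) : Prop :=
  ∀ (G : Grad) (M : ℝ), 0 < M → G.trace = 0 → (G.vortSq : ℝ) ≤ M ^ 2 →
    (1 - 3 / 4 * b) * (G.stretch : ℝ)
      ≤ θ * M * (G.sSq : ℝ) + a * M * ((G.sSq : ℝ) - (G.vortSq : ℝ) / 2) + b * (G.symCubeTrace : ℝ)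
        + c / M ^ 3 * ((G.sSq : ℝ) ^ 3 + (10 * (G.sSq : ℝ) ^ 2 + 450 * (G.sSq : ℝ) * M ^ 2 + 1178 * M ^ 4)
            * (M ^ 2 - (G.vortSq : ℝ)) - 1178 * M ^ 6)
        + M ^ 3 * ∑ k, cs k * (burkNode (lam k) M G - abar (lam k))

end Laminate

end Summit.NavierStokesRegularity.FunctionalMining

end
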